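import Summits.BirchSwinnertonDyer.Rank1Residual.ManinAdditive.ShimuraIndexFrickeLaw
import HarnessLib
import HarnessLib.Audit.Tags

/-!
# SCRATCH (cell bsd-f2-manin, -an g40, file L): WHERE CAN A SHIMURA `3`-KERNEL LIVE?  E-an-222 «only at `27 ∣ N`» (cell LAW, census)
# and E-an-222♭ «only where `Σ(N)` has `3`-torsion» (printed-derivable sieve, REF1 §R189 C1)

Route `ManinLocalTwoThree`, crux C3 `ManinPrimeToThreeAtNine` (stmt-BirchSwinnertonDyer-22968); MEMO-an §84.6.  Statement-only; proposed home
`Summits/BirchSwinnertonDyer/Rank1Residual/ManinAdditive/ShimuraThreeKernelLevel.lean` (typer T-an-51).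

CONTEXT.  The Shimura index `[Λ₀(f) : Λ₁(f)]` (`ShimuraIndexPrimeTo`, `…ShimuraIndexFrickeLaw`) is the degree of the Shimura cover `E₁ → E₀`
between the `X₁(N)`- and `X₀(N)`-optimal curves of the class of `f` (Stevens 1989 §2; Vatsal 2005 Rem. 1.8: `= #(E₀ ∩ Σ(N))`), so it divides
`#Σ(N)`; for `3 ∣ N` REF1's sieve (§R189 C1, group theory: the inertia subgroups of `(ℤ/N)ˣ/±1` over the cusps) gives `#Σ(N) = φ(N)/(2g)`,
`g = ∏ p^⌊v_p(N)/2⌋`, hence `3 ∣ [Λ₀:Λ₁] ⟹ 27 ∣ N ∨ ∃ p ∣ N, p ≡ 1 (mod 3)` — this is E-an-222♭ below (PRINTED-DERIVABLE; at the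
1 730 optimal `μ₃`-carriers `9 ∣ N < 5·10⁵` sitting at levels with `Σ(N)[3] = 0` the Shimura `3`-kernel is provably absent).
THE LAW E-an-222 (CONJECTURAL, census-backed): at `9 ∥ N` there is NO Shimura `3`-kernel at all — `3 ∣ [Λ₀(f):Λ₁(f)] ⟹ 27 ∣ N`.
Evidence (BC5 table = REF1 §R189 table C + an g39 census22): every certified index at `9 ∥ N` with `3 ∣ #Σ(N)` is `1` (468d1, 630f1, 657c1,
666c1, 819e1, 882h1, 1098l1, 1116e1, 1116f1, 1170g1, 1170k1: 11/11; 630i1, 693c1 inconclusive), every certified index at `9 ∥ N` with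
`Σ(N)[3] = 0` is `1` (414a1, 450b1, 522m1, …: provable case), and the only known Shimura `3`-kernels are 27a1 and 54a1 (`27 ∥ N`, index `3`,
REF1 §R182).  MECHANISM (heuristic, MEMO-an §84.6): a Shimura `3`-kernel makes `E₀[3] ≅ ℤ/3 ⊕ μ₃` SPLIT (rational `3`-torsion by E-an-128 ⟸
F★₀ ∧ E-es-80, plus `μ₃ ⊂ E₀ ∩ Σ(N)` of `μ`-type), i.e. `E₀` is a Hesse curve `x³ + y³ + z³ = 3kxyz`; the conjecture says such an optimal
curve meeting `Σ(N)` is wild at `3`.  PLACEMENT: E-an-222 is the LEVEL SHADOW of the Stein–Watkins `3`-isogeny conjecture (Stein–Watkins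
2002; Byeon–Yhee 2013 Thm. 1.1: (A) ⟹ (B) always, (B) ⟹ (A) for `N` square-free, `3 ∤ N`): SW «(B) `E₀`, `E₁` differ by a `3`-isogeny ⟹
(A) the class contains `y² + axy + y = x³` with `a² + 3a + 9` a prime power and no prime `≡ 1 (mod 6)` dividing `a − 3`»; such a curve has
`Δ = a³ − 27 = (a − 3)(a² + 3a + 9)`, so `3 ∣ N` forces `3 ∣ a`, `a² + 3a + 9 = 9(b² + b + 1)` a power of `3`, `a ∈ {0, −3, −6}`, i.e. the
curves 27a1, 54a1, 27a2 — `N ∈ {27, 54}`: UNDER SW, a Shimura `3`-kernel with `3 ∣ N` has `27 ∣ N`, which is E-an-222 (open in print at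
every non-square-free level).  CHEAPEST FALSIFIER: one optimal curve with `9 ∥ N` and `3 ∣ [Λ₀:Λ₁]` (D-an-25 / R-an-77 batch: the 47
optimal `μ₃`-carriers `666 < N ≤ 1500`, engine `shimura_index.py` 7abf70e87ce2cd1e with j-certificate).  USE: at `9 ∥ N` the `X₀`- and
`X₁`-Manin constants have the same `3`-adic valuation and E-an-221's hypothesis is void; E-an-222 is NOT needed for the C3 net of §84.3.
HONEST FRAMING: E-an-222 is a `@[conjecture]` cell candidate (11 + 4 non-trivial census rows; small); E-an-222♭ is print (Stevens 1989, Vatsal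
2005 Rem. 1.8, Ling–Oesterlé 1991) + REF1's validated sieve, typed here as a target for a Literature fact, not asserted.  Nothing is proved
about C3, Manin's conjecture or BSD by this file.  PARTITION 0 · beyond-print theorem: no.
[cite: Stevens1989, §2] [cite: Vatsal2005, Rem. 1.8] [cite: LingOesterle1991, Thm. 1 / Cor.] [cite: ByeonYhee2013, Thm. 1.1 (SW 3-isogeny conjecture)]

TYPER NOTE (typer g21, T-an-51).  SOURCE = HOME/an/g40/ShimuraThreeKernelLevel-an-g40.lean (file L) sha16 27ef2cacb9ccfe83 (72 l.; an: farm
rc 0 · 0 · 0, BC7 2/2 CLEAN Probe-bc7-L-g40.lean 1180ebe5b2f6cfb8; MEMO-an §84.6, HOME/an/MEMO-an-84.md) VERBATIM — module docstring, both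
`@[conjecture]` decls (an's own tags, bodies untouched) and the PROVED bookkeeping lemma; no typer delta besides this note.  Imports: landed
`…ManinAdditive.ShimuraIndexFrickeLaw` + HarnessLib(+Audit.Tags) — route-independent; namespace `…ManinAdditive.ShimuraThreeKernelLevel`.
ROWS: **E-an-222 `ShimuraThreeKernelForcesTwentySeven`** (cell LAW «no Shimura 3-kernel at 9 ∥ N»; BC5 = REF1 §R189 table C 11/11 certified
index-1 rows at 9 ∥ N with 3 ∣ #Σ(N) + an g39 census22 15/15; known 3-kernels 27a1 / 54a1 only (27 ∥ N); CHEAPEST FALSIFIER: one optimal curve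
with 9 ∥ N and 3 ∣ [Λ₀:Λ₁] — D-an-25 / R-an-77 batch, engine shimura_index.py 7abf70e87ce2cd1e), **E-an-222♭ `ShimuraThreeKernelNeedsSigmaThree`**
(PRINTED-DERIVABLE obligation node: Stevens 1989 §2 + Vatsal 2005 Rem. 1.8 «[Λ₀:Λ₁] = #(E₀ ∩ Σ(N))» + Ling–Oesterlé 1991 / REF1 §R189 C1 sieve;
F-an-15 asks the two inputs as Literature facts; cf. the KummerShimura-side companion landed UNCONDITIONALLY by C2/C3 LEAD p1 g17, p740101
`…Theorems.ManinLocalTwoThree.SigmaHabitat.three_dvd_totient_div_three_of_kummerShimura` «3 ∣ φ(N/3)»), PROVED `shimuraIndexPrimeTo_three_of_sieve`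
(E-an-222♭ ∧ 9 ∣ N ∧ ¬27 ∣ N ∧ no prime p ≡ 1 (3) dividing N ⟹ `ShimuraIndexPrimeTo 3 D.f`).  NOT IN PRINT (an): E-an-222 at non-square-free
level (it is the level shadow of the Stein–Watkins 3-isogeny conjecture: SW ⟹ E-an-222, a ∈ {0, −3, −6}).  REFUTER: ref1 / ref2 R-an-78 (iv)
PENDING at landing.  Typer checks: 3 decl names fresh tree-wide; cite keys Stevens1989 / Vatsal2005 / LingOesterle1991 / ByeonYhee2013 in
references.bib; no instances, no notation, no sorry.  PARTITION 0 · beyond-print theorem: no · bears_on: stmt-BirchSwinnertonDyer-22968 (C3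
`ManinPrimeToThreeAtNine`).  BSD is not proved by this; Manin `c = 1` is not proved by this; C3 OPEN. -/

set_option autoImplicit false

open WeierstrassCurve Literature.NumberTheory.EllipticCurves Literature.NumberTheory.EllipticCurves.ModularForms
open Summit.BirchSwinnertonDyer.Rank1Residual.ManinAdditive.KatoCurve

namespace Summit.BirchSwinnertonDyer.Rank1Residual.ManinAdditive.ShimuraThreeKernelLevel

/-- **E-an-222 (cell LAW, conjectural; census REF1 §R189 C + an g39 census22): a Shimura `3`-kernel forces `27 ∣ N`.**  For an elliptic
`W/ℚ` with an `X₀(N)`-datum `D` (so `D.f` is the rational newform of the class of `W`): `9 ∣ N ∧ 3 ∣ [Λ₀(f):Λ₁(f)] ⟹ 27 ∣ N`.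
Why it might fail: an optimal Hesse-type curve (`E₀[3] ≅ ℤ/3 ⊕ μ₃`) tame at `3` whose `μ₃` lies in `Σ(N)` (needs a prime `p ≡ 1 (mod 3)`
dividing `N`); none among the certified rows `N ≤ 1 188`. -/
@[conjecture]
def ShimuraThreeKernelForcesTwentySeven : Prop :=
  ∀ (W : WeierstrassCurve ℚ) [W.IsElliptic] {N : ℕ} [NeZero N] (D : ModularParametrizationData W N),
    3 ^ 2 ∣ N → ¬ ShimuraIndexPrimeTo 3 D.f → 3 ^ 3 ∣ N

/-- **E-an-222♭ (PRINTED-DERIVABLE sieve; Stevens 1989 §2 + Vatsal 2005 Rem. 1.8 «`[Λ₀:Λ₁] = #(E₀ ∩ Σ(N))`» + Ling–Oesterlé 1991 /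
REF1 §R189 C1 «`#Σ(N) = φ(N)/(2·∏ p^⌊v_p/2⌋)` for `3 ∣ N`»): a Shimura `3`-kernel needs `Σ(N)[3] ≠ 0`, i.e. `27 ∣ N` or a prime
`p ≡ 1 (mod 3)` dividing `N`.**  Typed as the target of a future Literature fact (not asserted here; tagged `@[conjecture]` = unproved
in the tree, an obligation node until the fact lands). [cite: Vatsal2005, Rem. 1.8] [cite: LingOesterle1991, Thm. 1] -/
@[conjecture]
def ShimuraThreeKernelNeedsSigmaThree : Prop :=
  ∀ (W : WeierstrassCurve ℚ) [W.IsElliptic] {N : ℕ} [NeZero N] (D : ModularParametrizationData W N),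
    3 ∣ N → ¬ ShimuraIndexPrimeTo 3 D.f → 3 ^ 3 ∣ N ∨ ∃ p : ℕ, p.Prime ∧ p ∣ N ∧ p % 3 = 1

/-- The two statements combine to: at `9 ∥ N` without a prime `p ≡ 1 (mod 3)` the Shimura `3`-kernel is absent by E-an-222♭ alone
(trivial bookkeeping, PROVED). [folklore] -/
theorem shimuraIndexPrimeTo_three_of_sieve (hS : ShimuraThreeKernelNeedsSigmaThree)
    (W : WeierstrassCurve ℚ) [W.IsElliptic] {N : ℕ} [NeZero N] (D : ModularParametrizationData W N)
    (h9 : 3 ^ 2 ∣ N) (h27 : ¬ 3 ^ 3 ∣ N) (hp : ∀ p : ℕ, p.Prime → p ∣ N → p % 3 ≠ 1) :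
    ShimuraIndexPrimeTo 3 D.f := by
  by_contra h
  rcases hS W D (dvd_trans (dvd_pow_self 3 two_ne_zero) h9) h with h3 | ⟨p, hpP, hpN, hp1⟩
  · exact h27 h3
  · exact hp p hpP hpN hp1

end Summit.BirchSwinnertonDyer.Rank1Residual.ManinAdditive.ShimuraThreeKernelLevel
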